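import Literature.Geometry.Riemannian.SimpleAHBoundarySphereProofs
import Literature.Geometry.Riemannian.HopfRinowHeineBorel
import Literature.Geometry.Riemannian.RiemannianCoveringComplete
import Literature.Geometry.Riemannian.RiemannianCoveringVolume
import Literature.Geometry.Lorentzian.CurvatureNaturality
import Literature.Geometry.Lorentzian.LeviCivitaCurvature
import HarnessLib

/-!
# The Cartan–Hadamard covering `exp_p` and the universal Riemannian covering `(T_pM, exp_p^* g)`

For a connected Riemannian manifold `(M, g)` (smooth metric, boundaryless finite-dimensional
model) whose closed distance balls are compact and whose sectional curvatures are `≤ 0` for every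
Levi-Civita connection — the hypothesis format of the summit routes (`∀ x r, IsCompact {y | d x y ≤ r}`,
`∀ cov, g.IsLeviCivita cov → K_cov ≤ 0`) — we prove, assembling the tree's layers:

* `curvatureForm_leviCivita_nonpos_of_sectionalCurvature_nonpos` — `K ≤ 0 ⇒ Rm(X,Y,Y,X) ≤ 0`;
* `isGeodesicallyComplete_of_isCompact_setOf_edist_le` — Hopf–Rinow (O'Neill 1983, Ch. 5, Thm. 21);
* `expMap_covering`, `expMap_immersion_covering` — **Cartan–Hadamard** (Lee 2018, Thm. 12.8, via
  the tree's `SimpleAH.exp_covering_of_complete`): `exp_p : T_pM = E → M` is a smooth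
  (`C^{∞+1}`) equidimensional immersion, a local diffeomorphism, surjective, and a covering map;
* for any smooth equidimensional immersion `F : E → M` (e.g. `exp_p`) and the pulled-back metric
  `F^* g = g.comap …` on the model vector space `E`: it is Riemannian (`isRiemannian_comap`); its
  closed distance balls are compact when `F` is a covering map (`isCompact_setOf_edist_le_comap`,
  O'Neill 1983, Ch. 7, Cor. 29 through `RiemannianCovering.isGeodesicallyComplete_comap_of_isCoveringMap`);
  its sectional curvatures, for EVERY Levi-Civita connection, are those of `g`
  (`sectionalCurvature_comap_eq`, `sectionalCurvature_comap_nonpos`, O'Neill 1983, Ch. 3,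
  Prop. 3.59); and local `d`-convexity of a subset of `M` (betweenness form) lifts to pointwise
  local `d̃`-convexity of its preimage (`locallyConvex_preimage_comap`, a local isometry being
  locally distance-preserving, Lee 2018, proof of Thm. 6.23).

So `(E, exp_p^* g)` is the universal Riemannian covering of `M` and is again Cartan–Hadamard in the
same hypothesis format (`E` is contractible, hence simply connected: Mathlib instances, or the
tree's `Literature.Topology.FourManifolds.simplyConnectedSpace_of_normedSpace`). First use: the
core reduction of crux `AhHadamardFilling` of `SmoothPoincare4` (locally convex far complements of a
complete `sec ≤ 0` filling lift to convex sets in the universal cover). Everything is proved; no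
definitions, no named facts.

## References

* J. M. Lee, *Introduction to Riemannian Manifolds*, 2nd ed. (2018), Thm. 12.8 (Cartan–Hadamard),
  Thm. 6.23 (proof). [Lee2018]
* B. O'Neill, *Semi-Riemannian Geometry* (1983), Ch. 3, Prop. 3.59; Ch. 5, Thm. 21; Ch. 7,
  Cor. 29. [ONeill1983]
-/

noncomputable section

open Bundle Set Function
open scoped Manifold ContDiff Topology

namespace Literature.Geometry.Riemannian

namespace HadamardExpCovering

open Literature.Geometry.Lorentzian Literature.Geometry.Lorentzian.PseudoRiemannianMetric

variable {E : Type*} [NormedAddCommGroup E] [NormedSpace ℝ E] {H : Type*} [TopologicalSpace H]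
  {I : ModelWithCorners ℝ E H} {M : Type*} [TopologicalSpace M] [ChartedSpace H M]
  [IsManifold I ∞ M] [FiniteDimensional ℝ E] [CompleteSpace E]
  (g : PseudoRiemannianMetric I ∞ E (TangentSpace I : M → Type _))

/-! ### Curvature sign and completeness in the routes' hypothesis format -/

/-- **`sec ≤ 0` (for every Levi-Civita connection) gives `Rm(X, Y, Y, X) ≤ 0` on all pairs** for
the tree's Levi-Civita connection `g.leviCivita`: on orthonormal pairs `K = Rm(X,Y,Y,X)`
(`sectionalCurvature_of_orthonormal`), and the Gram–Schmidt reduction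
`SimpleAH.curvatureForm_leviCivita_nonpos_of_orthonormal` extends the sign to all pairs.
[folklore] -/
theorem curvatureForm_leviCivita_nonpos_of_sectionalCurvature_nonpos [g.HasLeviCivita]
    (hg : g.IsRiemannian)
    (hsec : ∀ cov, g.IsLeviCivita cov →
      ∀ (x : M) (X Y : TangentSpace I x), g.sectionalCurvature cov x X Y ≤ 0)
    (x : M) (X Y : TangentSpace I x) : g.curvatureForm g.leviCivita x X Y Y X ≤ 0 := by
  have hLC : g.IsLeviCivita g.leviCivita := isLeviCivita_leviCivita_holds (g := g)
  have h2 : (2 : ℕ∞ω) ≤ (∞ : ℕ∞ω) := WithTop.coe_le_coe.2 le_top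
  refine SimpleAH.curvatureForm_leviCivita_nonpos_of_orthonormal h2 hg
    (fun x X Y hX hY hXY ↦ ?_) x X Y
  rw [← sectionalCurvature_of_orthonormal g g.leviCivita x hX hY hXY]
  exact hsec _ hLC x X Y

variable [I.Boundaryless]

/-- **Closed distance balls compact ⇒ geodesically complete** (Hopf–Rinow, the tree's
`isGeodesicallyComplete_iff_isCompact_setOf_edist_le`). [cite: ONeill1983, Ch. 5, Thm. 21] -/
theorem isGeodesicallyComplete_of_isCompact_setOf_edist_le [T2Space M] [ConnectedSpace M]
    [g.HasLeviCivita] (hg : g.IsRiemannian)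
    (hcpt : ∀ (x : M) (r : NNReal), IsCompact {y : M | g.edist hg x y ≤ r}) :
    IsGeodesicallyComplete g.leviCivita := by
  have hk1 : ((1 : ℕ∞) : ℕ∞ω) + 1 ≤ (∞ : ℕ∞ω) := by
    rw [show ((1 : ℕ∞) : ℕ∞ω) + 1 = 2 by norm_num]
    exact WithTop.coe_le_coe.2 le_top
  haveI : CovariantDerivative.ContMDiffCovariantDerivative g.leviCivita 1 :=
    ⟨g.isLocallyContMDiff_leviCivita_holds 1 hk1 univ isOpen_univ⟩
  exact (isGeodesicallyComplete_iff_isCompact_setOf_edist_le g le_rfl hg).2 hcpt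

/-! ### Cartan–Hadamard: `exp_p` is a smooth covering immersion -/

/-- **Cartan–Hadamard covering** (Lee 2018, Thm. 12.8, through the tree's
`SimpleAH.exp_covering_of_complete`): on a connected Riemannian manifold with compact closed
distance balls and `sec ≤ 0` (for every Levi-Civita connection), `exp_p : T_pM = E → M` is smooth,
a local diffeomorphism, surjective, and a covering map. [cite: Lee2018, Thm. 12.8] -/
theorem expMap_covering [T2Space M] [ConnectedSpace M] [g.HasLeviCivita] (hg : g.IsRiemannian)
    (hcpt : ∀ (x : M) (r : NNReal), IsCompact {y : M | g.edist hg x y ≤ r})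
    (hsec : ∀ cov, g.IsLeviCivita cov →
      ∀ (x : M) (X Y : TangentSpace I x), g.sectionalCurvature cov x X Y ≤ 0)
    (p : M) :
    ContMDiff 𝓘(ℝ, E) I ∞ (fun u : E ↦ expMap g.leviCivita p (show TangentSpace I p from u)) ∧
      IsLocalDiffeomorph 𝓘(ℝ, E) I ∞
        (fun u : E ↦ expMap g.leviCivita p (show TangentSpace I p from u)) ∧
      Surjective (fun u : E ↦ expMap g.leviCivita p (show TangentSpace I p from u)) ∧
      IsCoveringMap (fun u : E ↦ expMap g.leviCivita p (show TangentSpace I p from u)) := by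
  have hk1 : ((1 : ℕ∞) : ℕ∞ω) + 1 ≤ (∞ : ℕ∞ω) := by
    rw [show ((1 : ℕ∞) : ℕ∞ω) + 1 = 2 by norm_num]
    exact WithTop.coe_le_coe.2 le_top
  have hktop : ((⊤ : ℕ∞) : ℕ∞ω) + 1 ≤ (∞ : ℕ∞ω) := le_of_eq rfl
  haveI : CovariantDerivative.ContMDiffCovariantDerivative g.leviCivita 1 :=
    ⟨g.isLocallyContMDiff_leviCivita_holds 1 hk1 univ isOpen_univ⟩
  haveI : CovariantDerivative.ContMDiffCovariantDerivative g.leviCivita ∞ :=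
    ⟨g.isLocallyContMDiff_leviCivita_holds ⊤ hktop univ isOpen_univ⟩
  exact SimpleAH.exp_covering_of_complete hg
    (isGeodesicallyComplete_of_isCompact_setOf_edist_le g hg hcpt)
    (curvatureForm_leviCivita_nonpos_of_sectionalCurvature_nonpos g hg hsec) p

/-- **`exp_p` as a smooth equidimensional immersion and covering map** (the form consumed by
`PseudoRiemannianMetric.comap`: `C^{∞+1}` with injective differentials — Lee 2018, Thm. 11.12 /
Thm. 12.8, the tree's `CartanHadamard.mfderiv_expMap_injective`). [cite: Lee2018, Thm. 12.8] -/
theorem expMap_immersion_covering [T2Space M] [ConnectedSpace M] [g.HasLeviCivita]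
    (hg : g.IsRiemannian)
    (hcpt : ∀ (x : M) (r : NNReal), IsCompact {y : M | g.edist hg x y ≤ r})
    (hsec : ∀ cov, g.IsLeviCivita cov →
      ∀ (x : M) (X Y : TangentSpace I x), g.sectionalCurvature cov x X Y ≤ 0)
    (p : M) :
    ContMDiff 𝓘(ℝ, E) I (∞ + 1) (fun u : E ↦ expMap g.leviCivita p (show TangentSpace I p from u)) ∧
      (∀ v : E, Injective (mfderiv 𝓘(ℝ, E) I
        (fun u : E ↦ expMap g.leviCivita p (show TangentSpace I p from u)) v)) ∧
      Surjective (fun u : E ↦ expMap g.leviCivita p (show TangentSpace I p from u)) ∧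
      IsCoveringMap (fun u : E ↦ expMap g.leviCivita p (show TangentSpace I p from u)) := by
  have hk1 : ((1 : ℕ∞) : ℕ∞ω) + 1 ≤ (∞ : ℕ∞ω) := by
    rw [show ((1 : ℕ∞) : ℕ∞ω) + 1 = 2 by norm_num]
    exact WithTop.coe_le_coe.2 le_top
  have hktop : ((⊤ : ℕ∞) : ℕ∞ω) + 1 ≤ (∞ : ℕ∞ω) := le_of_eq rfl
  haveI : CovariantDerivative.ContMDiffCovariantDerivative g.leviCivita 1 :=
    ⟨g.isLocallyContMDiff_leviCivita_holds 1 hk1 univ isOpen_univ⟩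
  haveI : CovariantDerivative.ContMDiffCovariantDerivative g.leviCivita ∞ :=
    ⟨g.isLocallyContMDiff_leviCivita_holds ⊤ hktop univ isOpen_univ⟩
  have hc := isGeodesicallyComplete_of_isCompact_setOf_edist_le g hg hcpt
  have hsec' := curvatureForm_leviCivita_nonpos_of_sectionalCurvature_nonpos g hg hsec
  have hcov₁ : g.leviCivita.IsLocallyContMDiff 1 := g.isLocallyContMDiff_leviCivita_holds 1 hk1
  obtain ⟨-, -, hs, hcov⟩ := expMap_covering g hg hcpt hsec p
  exact ⟨contMDiff_expMap_infty (I := I) hc p,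
    CartanHadamard.mfderiv_expMap_injective (I := I) hg hsec' hcov₁ hc p, hs, hcov⟩

/-! ### The pulled-back metric `F^* g` on the model space is Cartan–Hadamard -/

variable {F : E → M} (hF : ContMDiff 𝓘(ℝ, E) I (∞ + 1) F)
  (hinj : ∀ u, Injective (mfderiv 𝓘(ℝ, E) I F u))

omit [CompleteSpace E] [I.Boundaryless] in
/-- The pullback `F^* g` of a Riemannian metric along an equidimensional immersion `F : E → M` of
the model vector space is Riemannian (O'Neill 1983, Ch. 3, p. 90). [cite: ONeill1983, Ch. 3, p. 90] -/
theorem isRiemannian_comap (hg : g.IsRiemannian) :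
    (g.comap contMDiff_pullbackBilin_holds F hF hinj rfl).IsRiemannian := fun u v hv ↦ by
  simp only [val_comap, Literature.Geometry.Lorentzian.pullbackBilin_apply]
  exact hg (F u) _ fun h0 ↦ hv (hinj u (by rw [map_zero]; exact h0))

/-- **Closed distance balls of the Riemannian covering `(E, F^* g)` are compact** when those of
`(M, g)` are and `F` is a covering map: `g` is complete (Hopf–Rinow), its Riemannian covering
`F^* g` is complete (O'Neill 1983, Ch. 7, Cor. 29, the tree's
`RiemannianCovering.isGeodesicallyComplete_comap_of_isCoveringMap`), hence Heine–Borel upstairs.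
[cite: ONeill1983, Ch. 7, Cor. 29] -/
theorem isCompact_setOf_edist_le_comap [T2Space M] [ConnectedSpace M] [g.HasLeviCivita]
    (hg : g.IsRiemannian)
    (hcpt : ∀ (x : M) (r : NNReal), IsCompact {y : M | g.edist hg x y ≤ r})
    (hcov : IsCoveringMap F) (x : E) (r : NNReal) :
    IsCompact {y : E | (g.comap contMDiff_pullbackBilin_holds F hF hinj rfl).edist
      (isRiemannian_comap g hF hinj hg) x y ≤ r} := by
  have hk1 : ((1 : ℕ∞) : ℕ∞ω) + 1 ≤ (∞ : ℕ∞ω) := by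
    rw [show ((1 : ℕ∞) : ℕ∞ω) + 1 = 2 by norm_num]
    exact WithTop.coe_le_coe.2 le_top
  set gt := g.comap contMDiff_pullbackBilin_holds F hF hinj rfl with hgt
  haveI hLt : gt.HasLeviCivita := gt.hasLeviCivita
  haveI : CovariantDerivative.ContMDiffCovariantDerivative gt.leviCivita 1 :=
    ⟨gt.isLocallyContMDiff_leviCivita_holds 1 hk1 univ isOpen_univ⟩
  have hc := isGeodesicallyComplete_of_isCompact_setOf_edist_le g hg hcpt
  have hct : IsGeodesicallyComplete gt.leviCivita :=
    RiemannianCovering.isGeodesicallyComplete_comap_of_isCoveringMap (g := g)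
      (hpb := contMDiff_pullbackBilin_holds) (hf := hF) (hf' := hinj) (hdim := rfl) hcov hc
  exact isCompact_setOf_edist_le gt le_rfl (isRiemannian_comap g hF hinj hg) hct x r

omit [I.Boundaryless] in
include hinj in
/-- **Sectional curvatures of the pulled-back metric** (O'Neill 1983, Ch. 3, Prop. 3.59,
naturality of the curvature under the local isometry `F : (E, F^*g) → (M, g)`, the tree's
`riemann_comap_apply`; and the curvature of ANY Levi-Civita connection of `F^*g` is its Riemann
tensor, `IsLeviCivita.curvature_eq_riemann`): for every Levi-Civita connection `cov` of `F^* g`,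
`K^{F^*g}_{cov}(X, Y)(u) = K^{g}(dF X, dF Y)(F u)`. [cite: ONeill1983, Ch. 3, Prop. 3.59] -/
theorem sectionalCurvature_comap_eq [g.HasLeviCivita]
    {cov : CovariantDerivative 𝓘(ℝ, E) E (TangentSpace 𝓘(ℝ, E) : E → Type _)}
    (hcov : (g.comap contMDiff_pullbackBilin_holds F hF hinj rfl).IsLeviCivita cov) (u : E)
    (X₀ Y₀ : TangentSpace 𝓘(ℝ, E) u) :
    (g.comap contMDiff_pullbackBilin_holds F hF hinj rfl).sectionalCurvature cov u X₀ Y₀ =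
      g.sectionalCurvature g.leviCivita (F u) (mfderiv 𝓘(ℝ, E) I F u X₀)
        (mfderiv 𝓘(ℝ, E) I F u Y₀) := by
  haveI := (g.comap contMDiff_pullbackBilin_holds F hF hinj rfl).hasLeviCivita
  have h2 : (2 : ℕ∞ω) ≤ (∞ : ℕ∞ω) := WithTop.coe_le_coe.2 le_top
  simp only [sectionalCurvature, curvatureForm]
  rw [hcov.curvature_eq_riemann h2 u]
  rw [riemann_comap_apply g contMDiff_pullbackBilin_holds hF hinj rfl u X₀ Y₀ Y₀]
  simp only [val_comap, Literature.Geometry.Lorentzian.pullbackBilin_apply]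
  rw [inverse_mfderiv_apply rfl (hinj u),
    Literature.Geometry.Lorentzian.mfderiv_mfderivEquivOfInjective_symm]
  rfl

omit [I.Boundaryless] in
include hinj in
/-- **`sec ≤ 0` lifts to the Riemannian covering `(E, F^* g)`** for every Levi-Civita connection of
`F^* g` — the curvature clause of the Cartan–Hadamard hypotheses for the universal cover, in the
routes' format. [cite: ONeill1983, Ch. 3, Prop. 3.59] -/
theorem sectionalCurvature_comap_nonpos [g.HasLeviCivita]
    (hsec : ∀ cov, g.IsLeviCivita cov →
      ∀ (x : M) (X Y : TangentSpace I x), g.sectionalCurvature cov x X Y ≤ 0)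
    (cov : CovariantDerivative 𝓘(ℝ, E) E (TangentSpace 𝓘(ℝ, E) : E → Type _))
    (hcov : (g.comap contMDiff_pullbackBilin_holds F hF hinj rfl).IsLeviCivita cov) (u : E)
    (X₀ Y₀ : TangentSpace 𝓘(ℝ, E) u) :
    (g.comap contMDiff_pullbackBilin_holds F hF hinj rfl).sectionalCurvature cov u X₀ Y₀ ≤ 0 := by
  rw [sectionalCurvature_comap_eq g hF hinj hcov u X₀ Y₀]
  exact hsec _ (isLeviCivita_leviCivita_holds (g := g)) _ _ _

/-- **Local `d`-convexity lifts to the Riemannian covering.** Let `F : (E, F^*g) → (M, g)` be a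
smooth equidimensional immersion (a local isometry by construction) and `C ⊆ M` a set which is
`δ`-locally `d`-convex in the betweenness form (`d(p,m) + d(m,q) = d(p,q)` with `p, q ∈ C`,
`d(p,q) < δ` forces `m ∈ C`). Then `F ⁻¹' C` is locally `d̃`-convex at every point `x₀`, with a
pointwise radius: a local isometry is locally distance-preserving and injective (Lee 2018, proof of
Thm. 6.23, the tree's `RiemannianCovering.exists_nhds_edist_comp_eq`), so a `d̃`-between point of
two points of `F ⁻¹' C` close to `x₀` projects to a `d`-between point of two `δ`-close points of
`C`. [cite: Lee2018, Thm. 6.23 (proof)] -/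
theorem locallyConvex_preimage_comap [T2Space M] (hg : g.IsRiemannian) {C : Set M} {δ : ℝ}
    (hδ : 0 < δ)
    (hC : ∀ p ∈ C, ∀ q ∈ C, g.edist hg p q < ENNReal.ofReal δ →
      ∀ m : M, g.edist hg p m + g.edist hg m q = g.edist hg p q → m ∈ C)
    (x₀ : E) :
    ∃ δ' : ℝ, 0 < δ' ∧ ∀ q ∈ F ⁻¹' C, ∀ q' ∈ F ⁻¹' C,
      (g.comap contMDiff_pullbackBilin_holds F hF hinj rfl).edist (isRiemannian_comap g hF hinj hg)
          x₀ q < ENNReal.ofReal δ' →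
      (g.comap contMDiff_pullbackBilin_holds F hF hinj rfl).edist (isRiemannian_comap g hF hinj hg)
          x₀ q' < ENNReal.ofReal δ' →
      ∀ m : E,
        (g.comap contMDiff_pullbackBilin_holds F hF hinj rfl).edist (isRiemannian_comap g hF hinj hg)
            q m +
          (g.comap contMDiff_pullbackBilin_holds F hF hinj rfl).edist
            (isRiemannian_comap g hF hinj hg) m q' =
        (g.comap contMDiff_pullbackBilin_holds F hF hinj rfl).edist (isRiemannian_comap g hF hinj hg)
            q q' → m ∈ F ⁻¹' C := by
  haveI : LocallyCompactSpace M := Manifold.locallyCompact_of_finiteDimensional (I := I)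
  set gt := g.comap contMDiff_pullbackBilin_holds F hF hinj rfl with hgt
  have hgt : gt.IsRiemannian := isRiemannian_comap g hF hinj hg
  have hloc : IsLocalDiffeomorph 𝓘(ℝ, E) I ∞ F :=
    RiemannianCovering.isLocalDiffeomorph_of_injective_mfderiv hF hinj rfl
  have hF1 : ContMDiff 𝓘(ℝ, E) I 1 F := hF.of_le (by exact_mod_cast le_top)
  have hiso : ∀ (x : E) (v w : TangentSpace 𝓘(ℝ, E) x),
      g.val (F x) (mfderiv 𝓘(ℝ, E) I F x v) (mfderiv 𝓘(ℝ, E) I F x w) = gt.val x v w :=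
    fun x v w ↦ rfl
  obtain ⟨U, hUo, hx₀U, -, hdist⟩ :=
    RiemannianCovering.exists_nhds_edist_comp_eq hgt hg hF1 hiso (hloc x₀)
  obtain ⟨r, hr, hrU⟩ := exists_setOf_edist_lt_subset hgt (hUo.mem_nhds hx₀U)
  obtain ⟨p, hp0, hpr⟩ := ENNReal.lt_iff_exists_nnreal_btwn.1 hr
  have hp : (0 : ℝ) < p := by exact_mod_cast hp0
  set δ' : ℝ := min ((p : ℝ) / 3) (δ / 3) with hδ'
  have hδ'pos : 0 < δ' := lt_min (by positivity) (by positivity)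
  have hδ'p : 3 * δ' ≤ p := by
    have : δ' ≤ (p : ℝ) / 3 := min_le_left _ _
    linarith
  have hδ'δ : 2 * δ' < δ := by
    have : δ' ≤ δ / 3 := min_le_right _ _
    linarith
  refine ⟨δ', hδ'pos, fun q hq q' hq' hxq hxq' m hm ↦ ?_⟩
  -- membership in `U` of `q`, `q'`, `m`
  have hmemU : ∀ z : E, gt.edist hgt x₀ z < ENNReal.ofReal (3 * δ') → z ∈ U := by
    intro z hz
    apply hrU
    show gt.edist hgt x₀ z < r
    refine lt_of_lt_of_le hz (le_trans ?_ hpr.le)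
    rw [← ENNReal.ofReal_coe_nnreal]
    exact ENNReal.ofReal_le_ofReal hδ'p
  have h13 : ENNReal.ofReal δ' ≤ ENNReal.ofReal (3 * δ') :=
    ENNReal.ofReal_le_ofReal (by linarith)
  have hqU : q ∈ U := hmemU q (lt_of_lt_of_le hxq h13)
  have hq'U : q' ∈ U := hmemU q' (lt_of_lt_of_le hxq' h13)
  have hqq' : gt.edist hgt q q' < ENNReal.ofReal (2 * δ') := by
    calc gt.edist hgt q q' ≤ gt.edist hgt q x₀ + gt.edist hgt x₀ q' := gt.edist_triangle hgt _ _ _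
      _ < ENNReal.ofReal δ' + ENNReal.ofReal δ' := by
          rw [gt.edist_comm hgt q x₀]
          exact ENNReal.add_lt_add hxq hxq'
      _ = ENNReal.ofReal (2 * δ') := by
          rw [← ENNReal.ofReal_add hδ'pos.le hδ'pos.le]
          ring_nf
  have hqm : gt.edist hgt q m ≤ gt.edist hgt q q' := by
    rw [← hm]
    exact le_self_add
  have hmU : m ∈ U := by
    apply hmemU
    calc gt.edist hgt x₀ m ≤ gt.edist hgt x₀ q + gt.edist hgt q m := gt.edist_triangle hgt _ _ _
      _ < ENNReal.ofReal δ' + ENNReal.ofReal (2 * δ') :=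
          ENNReal.add_lt_add hxq (lt_of_le_of_lt hqm hqq')
      _ = ENNReal.ofReal (3 * δ') := by
          rw [← ENNReal.ofReal_add hδ'pos.le (by linarith)]
          ring_nf
  -- project the betweenness relation and apply the local convexity of `C`
  have hbet : g.edist hg (F q) (F m) + g.edist hg (F m) (F q') = g.edist hg (F q) (F q') := by
    rw [hdist q hqU m hmU, hdist m hmU q' hq'U, hdist q hqU q' hq'U]
    exact hm
  have hclose : g.edist hg (F q) (F q') < ENNReal.ofReal δ := by
    rw [hdist q hqU q' hq'U]
    exact lt_trans hqq' ((ENNReal.ofReal_lt_ofReal_iff hδ).2 hδ'δ)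
  exact hC (F q) hq (F q') hq' hclose (F m) hbet

end HadamardExpCovering

end Literature.Geometry.Riemannian

end
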